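import Summits.CriticalPhenomena.PercolationContinuityZ3.Theorems.PercNearOneGluingNoHeavyLowerTailSunflowerTBernMerge
import HarnessLib

/-!
# `NoHeavyLowerTail` (crux stmt-CriticalPhenomena-4575), abstract sunflower cubic: T-BERN — merging an h-petal into a
# leveraged tight petal

Support file (seat `prim-ineq-prove-1` gen 65; `--supports stmt-CriticalPhenomena-4575`).  No `sorry`, no named facts.
Memo: run/shared/lean/prim/prim-ineq-prove-1/FINDING-REDUCTION-prove1-g65.md §1 (step R4).

Companion of `…SunflowerTBernMerge`.  An h-petal `i` (`u_i = m_i = b`) next to a TIGHT petal `r` (`m_r = u_r`) which is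
leveraged (`β·m_r ≤ b·vv_r`, normalised `z_r ≥ w_r`): the pair is dominated coefficientwise by {floor, `r'`} where `r'` is `r`
with its `vv` raised so that `g_{r'} = g_rg_i/a₀` (`coefDom_merge_hT`, because `r` is γ-heavy), and `r'` with the remaining
petals is admissible on `t.erase i` (`admissibleOn_merge_hT`; the point is `β·vv_{r'} ≤ vv_r·vv_i`, which is where
`β m_r ≤ b vv_r` enters).  Hence **`domOn_of_merge_hT`**: `DomOn` for the merged family on `t.erase i` gives `DomOn` on `t`.
In the reduction of `TBern` this removes the configuration {h-petal, leveraged T2 petal}.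
-/

noncomputable section

namespace Summit.CriticalPhenomena.PercolationContinuityZ3.Theorems.SunflowerPartition

namespace SafeCalc

namespace LinkedCurrency

open Finset Polynomial

variable {ι : Type*}

/-- **The h-into-T polynomial step**: `(A₀X+g_i)(A_rX+g_r) ≤_coef (A₀X+a₀)(A_rX+g')` when `a₀g' = g_rg_i`, `a₀ ≤ g_i`,
`a₀A_r ≤ A₀g_r` (the petal `r` is γ-heavy), `0 < a₀`. [this work] -/
theorem coefDom_merge_hT {A₀ a₀ Ar gi gr g' : ℝ} (ha₀ : 0 < a₀) (hgi : a₀ ≤ gi)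
    (hheavy : a₀ * Ar ≤ A₀ * gr) (hg' : a₀ * g' = gr * gi) :
    CoefDom ((C A₀ * X + C gi) * (C Ar * X + C gr)) ((C A₀ * X + C a₀) * (C Ar * X + C g')) := by
  refine coefDom_step (le_of_eq (by ring)) (by rw [hg']; ring_nf; exact le_rfl) ?_
  -- a₀·(A₀ g_r + g_i A_r) ≤ a₀·(A₀ g' + a₀ A_r) ⟸ (A₀ g_r − a₀ A_r)(g_i − a₀) ≥ 0
  have h1 : 0 ≤ (A₀ * gr - a₀ * Ar) * (gi - a₀) := mul_nonneg (sub_nonneg.2 hheavy) (sub_nonneg.2 hgi)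
  have h2 : a₀ * (A₀ * gr + gi * Ar) ≤ a₀ * (A₀ * g' + a₀ * Ar) := by
    have e : a₀ * (A₀ * g' + a₀ * Ar) = A₀ * (gr * gi) + a₀ * a₀ * Ar := by rw [← hg']; ring
    rw [e]; nlinarith
  exact le_of_mul_le_mul_left h2 ha₀

/-- **The h-into-T merge keeps admissibility.**  h-petal `i` (`m_i = b`), tight petal `r ≠ i` (`m_r = u_r`, `β m_r ≤ b vv_r`) of an
admissible family, `0 < s ≤ 1`; `v'` with `a₀((1−s)m_r + s v') = g_r g_i`.  Then the family on `t.erase i` with `vv_r := v'` is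
admissible. [this work] -/
theorem admissibleOn_merge_hT [DecidableEq ι] {s b β V : ℝ} (hb : 0 < b) (hbβ : b ≤ β) (hs0 : 0 < s) (hs1 : s ≤ 1)
    {t : Finset ι} {u vv m : ι → ℝ} (hadm : AdmissibleOn s b β V t u vv m) {i r : ι} (hri : r ≠ i) (hi : i ∈ t)
    (hr : r ∈ t) (hui : u i = b) (hmi : m i = b) (hlev : β * m r ≤ b * vv r) {v' : ℝ}
    (hv' : ((1 - s) * b + s * β) * ((1 - s) * m r + s * v') = ((1 - s) * m r + s * vv r) * ((1 - s) * b + s * vv i)) :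
    AdmissibleOn s b β V (t.erase i) u (Function.update vv r v') m := by
  obtain ⟨hub, hu1, hvβ, hv1, hmb, hmu, hmv, hpu, hpv, hpg⟩ := hadm
  have hs' : 0 ≤ 1 - s := sub_nonneg.2 hs1
  have hβ : 0 < β := hb.trans_le hbβ
  have ha₀ : 0 < (1 - s) * b + s * β := by nlinarith
  have hvi : β ≤ vv i := hvβ i hi
  have hvr : β ≤ vv r := hvβ r hr
  have hmr0 : b ≤ m r := hmb r hr
  -- v' ≥ vv_r (g_i ≥ a₀) and β v' ≤ vv_r vv_i (uses β m_r ≤ b vv_r)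
  have hgi : (1 - s) * b + s * β ≤ (1 - s) * b + s * vv i := by nlinarith
  have hgr0 : 0 ≤ (1 - s) * m r + s * vv r := by nlinarith
  have hv'ge : vv r ≤ v' := by
    have h1 : ((1 - s) * m r + s * vv r) * ((1 - s) * b + s * β) ≤
        ((1 - s) * m r + s * vv r) * ((1 - s) * b + s * vv i) := mul_le_mul_of_nonneg_left hgi hgr0
    have h2 : ((1 - s) * b + s * β) * ((1 - s) * m r + s * vv r) ≤ ((1 - s) * b + s * β) * ((1 - s) * m r + s * v') := by
      rw [hv']; linarith
    have h3 := le_of_mul_le_mul_left h2 ha₀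
    have h4 : s * vv r ≤ s * v' := by linarith
    exact le_of_mul_le_mul_left h4 hs0
  have hv'le : β * v' ≤ vv r * vv i := by
    -- a₀((1−s)m_rβ + s vv_r vv_i) − β g_r g_i = s(1−s)(vv_i−β)(b vv_r − β m_r) ≥ 0
    have key : ((1 - s) * b + s * β) * ((1 - s) * m r * β + s * (vv r * vv i)) -
        β * (((1 - s) * m r + s * vv r) * ((1 - s) * b + s * vv i)) =
        s * (1 - s) * ((vv i - β) * (b * vv r - β * m r)) := by ring
    have hpos : 0 ≤ s * (1 - s) * ((vv i - β) * (b * vv r - β * m r)) :=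
      mul_nonneg (mul_nonneg hs0.le hs') (mul_nonneg (sub_nonneg.2 hvi) (sub_nonneg.2 hlev))
    have h2 : ((1 - s) * b + s * β) * (β * ((1 - s) * m r + s * v')) ≤
        ((1 - s) * b + s * β) * ((1 - s) * m r * β + s * (vv r * vv i)) := by
      have e : ((1 - s) * b + s * β) * (β * ((1 - s) * m r + s * v')) =
          β * (((1 - s) * b + s * β) * ((1 - s) * m r + s * v')) := by ring
      rw [e, hv']; linarith
    have h3 := le_of_mul_le_mul_left h2 ha₀
    have h4 : s * (β * v') ≤ s * (vv r * vv i) := by linarith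
    exact le_of_mul_le_mul_left h4 hs0
  have hrt' : r ∈ t.erase i := mem_erase.2 ⟨hri, hr⟩
  have hcard : t.card - 1 = ((t.erase i).card - 1) + 1 := by
    rw [card_erase_of_mem hi]
    have h1 : (t.erase i).card ≥ 1 := card_pos.2 ⟨r, hrt'⟩
    rw [card_erase_of_mem hi] at h1; omega
  have sub : ∀ {p : ι → Prop}, (∀ k ∈ t, p k) → ∀ k ∈ t.erase i, p k := fun hp k hk => hp k (mem_of_mem_erase hk)
  have hupd_r : Function.update vv r v' r = v' := Function.update_self r v' vv
  have hupd : ∀ k, k ≠ r → Function.update vv r v' k = vv k := fun k hk => Function.update_of_ne hk v' vv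
  -- vv_r vv_i ≤ β V from the vv-budget
  have hriV : vv r * vv i ≤ β * V := by
    have hrest : β ^ ((t.erase i).erase r).card ≤ ∏ l ∈ (t.erase i).erase r, vv l := by
      calc β ^ ((t.erase i).erase r).card = ∏ l ∈ (t.erase i).erase r, β := by rw [prod_const]
        _ ≤ ∏ l ∈ (t.erase i).erase r, vv l := prod_le_prod (fun _ _ => hβ.le)
            fun l hl => hvβ l (mem_of_mem_erase (mem_of_mem_erase hl))
    have hsplit : ∏ l ∈ t, vv l = vv i * (vv r * ∏ l ∈ (t.erase i).erase r, vv l) := by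
      rw [mul_prod_erase (t.erase i) vv hrt', mul_prod_erase t vv hi]
    have hβpow : 0 < β ^ ((t.erase i).erase r).card := pow_pos hβ _
    have h1 : vv i * (vv r * β ^ ((t.erase i).erase r).card) ≤ β ^ (t.card - 1) * V := by
      calc vv i * (vv r * β ^ ((t.erase i).erase r).card) ≤ vv i * (vv r * ∏ l ∈ (t.erase i).erase r, vv l) :=
            mul_le_mul_of_nonneg_left (mul_le_mul_of_nonneg_left hrest (hβ.le.trans hvr)) (hβ.le.trans hvi)
        _ = ∏ l ∈ t, vv l := hsplit.symm
        _ ≤ β ^ (t.card - 1) * V := hpv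
    have e : β ^ (t.card - 1) = β ^ ((t.erase i).erase r).card * β := by
      rw [← pow_succ]; congr 1
      rw [card_erase_of_mem hrt', card_erase_of_mem hi]; omega
    rw [e] at h1
    have h3 : (vv r * vv i) * β ^ ((t.erase i).erase r).card ≤ (β * V) * β ^ ((t.erase i).erase r).card := by
      nlinarith
    exact le_of_mul_le_mul_right h3 hβpow
  refine ⟨sub hub, sub hu1, ?_, ?_, sub hmb, sub hmu, ?_, ?_, ?_, ?_⟩
  · intro k hk
    by_cases hkr : k = r
    · rw [hkr, hupd_r]; exact hvr.trans hv'ge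
    · rw [hupd k hkr]; exact hvβ k (mem_of_mem_erase hk)
  · intro k hk
    by_cases hkr : k = r
    · rw [hkr, hupd_r]
      have h4 : β * v' ≤ β * V := hv'le.trans hriV
      exact le_of_mul_le_mul_left h4 hβ
    · rw [hupd k hkr]; exact hv1 k (mem_of_mem_erase hk)
  · intro k hk
    by_cases hkr : k = r
    · rw [hkr, hupd_r]; exact (hmv r hr).trans hv'ge
    · rw [hupd k hkr]; exact hmv k (mem_of_mem_erase hk)
  · -- u-budget: ∏_{t∖i} u = (∏_t u)/b
    rw [← mul_prod_erase t u hi, hui, hcard, pow_succ, mul_comm (b ^ _) b] at hpu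
    exact le_of_mul_le_mul_left hpu hb
  · -- vv-budget
    have hsplit : ∏ l ∈ t.erase i, Function.update vv r v' l = v' * ∏ l ∈ (t.erase i).erase r, vv l := by
      rw [← mul_prod_erase (t.erase i) _ hrt', hupd_r]
      congr 1
      exact prod_congr rfl fun l hl => hupd l (mem_erase.1 hl).1
    have hsplit2 : ∏ l ∈ t, vv l = vv i * (vv r * ∏ l ∈ (t.erase i).erase r, vv l) := by
      rw [mul_prod_erase (t.erase i) vv hrt', mul_prod_erase t vv hi]
    have hrest0 : 0 ≤ ∏ l ∈ (t.erase i).erase r, vv l :=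
      prod_nonneg fun l hl => hβ.le.trans (hvβ l (mem_of_mem_erase (mem_of_mem_erase hl)))
    rw [hsplit]
    rw [hsplit2, hcard, pow_succ] at hpv
    have h1 : β * (v' * ∏ l ∈ (t.erase i).erase r, vv l) ≤ β * (β ^ ((t.erase i).card - 1) * V) := by
      calc β * (v' * ∏ l ∈ (t.erase i).erase r, vv l) = (β * v') * ∏ l ∈ (t.erase i).erase r, vv l := by ring
        _ ≤ (vv r * vv i) * ∏ l ∈ (t.erase i).erase r, vv l := mul_le_mul_of_nonneg_right hv'le hrest0
        _ = vv i * (vv r * ∏ l ∈ (t.erase i).erase r, vv l) := by ring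
        _ ≤ β ^ ((t.erase i).card - 1) * β * V := hpv
        _ = β * (β ^ ((t.erase i).card - 1) * V) := by ring
    exact le_of_mul_le_mul_left h1 hβ
  · -- g-budget
    have hsplit : ∏ l ∈ t.erase i, ((1 - s) * m l + s * Function.update vv r v' l) =
        ((1 - s) * m r + s * v') * ∏ l ∈ (t.erase i).erase r, ((1 - s) * m l + s * vv l) := by
      rw [← mul_prod_erase (t.erase i) _ hrt', hupd_r]
      congr 1
      exact prod_congr rfl fun l hl => by rw [hupd l (mem_erase.1 hl).1]
    have hsplit2 : ∏ l ∈ t, ((1 - s) * m l + s * vv l) =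
        ((1 - s) * m i + s * vv i) * (((1 - s) * m r + s * vv r) * ∏ l ∈ (t.erase i).erase r, ((1 - s) * m l + s * vv l)) := by
      rw [mul_prod_erase (t.erase i) (fun l => (1 - s) * m l + s * vv l) hrt',
        mul_prod_erase t (fun l => (1 - s) * m l + s * vv l) hi]
    have hrest0 : 0 ≤ ∏ l ∈ (t.erase i).erase r, ((1 - s) * m l + s * vv l) :=
      prod_nonneg fun l hl => by
        have hl' := mem_of_mem_erase (mem_of_mem_erase hl)
        exact add_nonneg (mul_nonneg hs' (hb.le.trans (hmb l hl'))) (mul_nonneg hs0.le (hβ.le.trans (hvβ l hl')))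
    rw [hsplit]
    rw [hsplit2, hcard, pow_succ] at hpg
    have h1 : ((1 - s) * b + s * β) * (((1 - s) * m r + s * v') * ∏ l ∈ (t.erase i).erase r, ((1 - s) * m l + s * vv l)) ≤
        ((1 - s) * b + s * β) * (((1 - s) * b + s * β) ^ ((t.erase i).card - 1) * V) := by
      calc ((1 - s) * b + s * β) * (((1 - s) * m r + s * v') * ∏ l ∈ (t.erase i).erase r, ((1 - s) * m l + s * vv l))
          = (((1 - s) * b + s * β) * ((1 - s) * m r + s * v')) * ∏ l ∈ (t.erase i).erase r, ((1 - s) * m l + s * vv l) := by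
            ring
        _ = ((1 - s) * m i + s * vv i) * (((1 - s) * m r + s * vv r) *
              ∏ l ∈ (t.erase i).erase r, ((1 - s) * m l + s * vv l)) := by rw [hv', hmi]; ring
        _ ≤ ((1 - s) * b + s * β) ^ ((t.erase i).card - 1) * ((1 - s) * b + s * β) * V := hpg
        _ = ((1 - s) * b + s * β) * (((1 - s) * b + s * β) ^ ((t.erase i).card - 1) * V) := by ring
    exact le_of_mul_le_mul_left h1 ha₀

/-- **Merging an h-petal into a leveraged tight petal.**  With the data of `admissibleOn_merge_hT` (and `u_i = b`, `β ≤ 1`):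
`DomOn` for the merged family on `t.erase i` implies `DomOn` for the original family on `t`. [this work] -/
theorem domOn_of_merge_hT [DecidableEq ι] {s b β V : ℝ} (hb : 0 < b) (hbβ : b ≤ β) (hβ1 : β ≤ 1) (hs0 : 0 < s)
    (hs1 : s ≤ 1) {t : Finset ι} {u vv m : ι → ℝ} (hadm : AdmissibleOn s b β V t u vv m) {i r : ι} (hri : r ≠ i)
    (hi : i ∈ t) (hr : r ∈ t) (hui : u i = b) (hmi : m i = b) (hmr : m r = u r) {v' : ℝ}
    (hv' : ((1 - s) * b + s * β) * ((1 - s) * m r + s * v') = ((1 - s) * m r + s * vv r) * ((1 - s) * b + s * vv i))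
    (hdom : DomOn s b β V (t.erase i) u (Function.update vv r v') m) : DomOn s b β V t u vv m := by
  obtain ⟨hub, _, hvβ, _, hmb, _, _, _, _, _⟩ := hadm
  have hs' : 0 ≤ 1 - s := sub_nonneg.2 hs1
  have hβ : 0 < β := hb.trans_le hbβ
  have ha₀ : 0 < (1 - s) * b + s * β := by nlinarith
  refine domOn_of_merge_pair hs0.le hs1 hb.le hβ.le hri hr hi (fun k hk => hb.le.trans (hub k hk))
    (fun k hk => hb.le.trans (hmb k hk)) (fun k hk => hβ.le.trans (hvβ k hk))
    (fun k _ hkr => Function.update_of_ne hkr v' vv) ?_ hdom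
  rw [Function.update_self, hui, hmi]
  refine coefDom_merge_hT ha₀ (by nlinarith [hvβ i hi])
    (gammaHeavy_of_tight hs0.le hs1 hb.le hβ1 (hub r hr) (hvβ r hr) hmr) ?_
  linarith [hv']

end LinkedCurrency

end SafeCalc

end Summit.CriticalPhenomena.PercolationContinuityZ3.Theorems.SunflowerPartition
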